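import Summits.CriticalPhenomena.PercolationContinuityZ3.Theorems.PercNearOneGluingNearOneGluingKnLemma3i
import Literature.Probability.Percolation.KozmaNitzanPinning
import Literature.Probability.Percolation.LongRangeKernelPercolationProofs
import HarnessLib

/-! # Crux `PercNearOneGluing.AdditiveGluing` (stmt-CriticalPhenomena-4576) — the unglued hypothesis survives gluing pairs at the relay
# (seat (b) V⁺-form, depth prover `png-dp-vplus`)

Support file (`--supports stmt-CriticalPhenomena-4576`); no definitions, no named facts.

Kozma–Nitzan's Lemma 3(i) (landed as `knLemma3i`, sibling crux NearOneGluing): if `μ(d↔b) ≤ μ(a↔b)` then `μ(d↔b ∩ Q) ≤ μ(a↔b ∩ Q)` for every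
event `Q` increasing in the open edge cluster of `a`.  Here we record the two consequences the finger multi-edge Lemma 3 (`stub_fingerML3_vp`) needs:
* `unglued_hyp_restrict_pairsOpen` — the stub's hypothesis `μ_K(d↔b) ≤ μ_K(a↔b)` LOCALISES to the cylinder "the pairs `s(v,a)`, `v ∈ S`, are open"
  (a relay touched by prescribed fingers);
* `unglued_hyp_transfer_pairsGlued` — hence it TRANSFERS to the weighting in which those pairs are glued (`pinW K F F`, `F` = those pairs), i.e.
  to the partially glued world in which the fingers of `S` are merged with `a` — the hypotheses are available in every partial gluing that is
  attached to the relay, although they are NOT available after killing pairs (RML3* refutation) or after gluing fingers among themselves.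
[cite: KozmaNitzan2024, Lemma 3(i) (pp. 6–7), Lemma 5 (p. 13)]
-/

namespace Summit.CriticalPhenomena.PercolationContinuityZ3.Theorems

open MeasureTheory Set
open Literature.Probability.LatticeModels (prodBernoulli)
open Literature.Probability.Percolation (BondConfig openConn openGraph openEdgeCluster pinW localCylinder)

noncomputable section
open Classical

section FingerHypTransfer

open Literature.Probability.LatticeModels Literature.Probability.Percolation

variable {n : ℕ}

/-- **The unglued hypothesis localises to "these pairs at `a` are open".**  If `μ_K(d↔b) ≤ μ_K(a↔b)` then for every finite set `S` of vertices
`≠ a`: `μ_K(d↔b ∩ {∀ v ∈ S, s(v,a) open}) ≤ μ_K(a↔b ∩ {∀ v ∈ S, s(v,a) open})` — the cylinder is increasing in the open edge cluster of `a`.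
[cite: KozmaNitzan2024, Lemma 3(i) (pp. 6–7)] -/
theorem unglued_hyp_restrict_pairsOpen (K : Sym2 (Fin n) → unitInterval) (S : Finset (Fin n)) (d a b : Fin n)
    (hS : ∀ v ∈ S, v ≠ a)
    (hle : (prodBernoulli K).real (openConn d b) ≤ (prodBernoulli K).real (openConn a b)) :
    (prodBernoulli K).real (openConn d b ∩ {ω : BondConfig (Fin n) | ∀ v ∈ S, s(v, a) ∈ ω}) ≤
      (prodBernoulli K).real (openConn a b ∩ {ω : BondConfig (Fin n) | ∀ v ∈ S, s(v, a) ∈ ω}) := by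
  set Q : Set (BondConfig (Fin n)) := {ω | ∀ v ∈ S, s(v, a) ∈ ω} with hQdef
  have hQ : ∀ ω ω' : BondConfig (Fin n), ω ∈ Q → openEdgeCluster ω a ⊆ openEdgeCluster ω' a → ω' ∈ Q := by
    intro ω ω' hω hsub v hv
    have hmem : s(v, a) ∈ openEdgeCluster ω a := by
      refine (mem_openEdgeCluster_iff ω a _).2 ⟨hω v hv, fun h => hS v hv (Sym2.mk_isDiag_iff.1 h), fun x hx => ?_⟩
      rcases Sym2.mem_iff.1 hx with rfl | rfl
      · exact ((openGraph_adj ω a x).2 ⟨by rw [Sym2.eq_swap]; exact hω x hv, (hS x hv).symm⟩).reachable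
      · exact SimpleGraph.Reachable.refl _
    exact openEdgeCluster_subset ω' a (hsub hmem)
  have h := knLemma3i n K d a b Q 0 hQ le_rfl (by simpa using hle)
  simpa using h

/-- **The unglued hypothesis transfers to the weighting with those pairs glued.**  `F` = the pairs `s(v,a)`, `v ∈ S` (all of positive weight);
`pinW K F F` = `K` with the pairs of `F` set to `1`.  If `μ_K(d↔b) ≤ μ_K(a↔b)` then `μ_{pinW K F F}(d↔b) ≤ μ_{pinW K F F}(a↔b)`.
[cite: KozmaNitzan2024, Lemma 3(i) (pp. 6–7), Lemma 5 (p. 13)] -/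
theorem unglued_hyp_transfer_pairsGlued (K : Sym2 (Fin n) → unitInterval) (S : Finset (Fin n)) (d a b : Fin n)
    (hS : ∀ v ∈ S, v ≠ a) (hpos : ∀ v ∈ S, 0 < (K s(v, a) : ℝ))
    (hle : (prodBernoulli K).real (openConn d b) ≤ (prodBernoulli K).real (openConn a b)) :
    (prodBernoulli (pinW K (↑(S.image (fun v => s(v, a))) : Set (Sym2 (Fin n))) ↑(S.image (fun v => s(v, a))))).real (openConn d b) ≤
      (prodBernoulli (pinW K (↑(S.image (fun v => s(v, a))) : Set (Sym2 (Fin n))) ↑(S.image (fun v => s(v, a))))).real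
        (openConn a b) := by
  set F : Finset (Sym2 (Fin n)) := S.image (fun v => s(v, a)) with hF
  have hcyl : {ω : BondConfig (Fin n) | ∀ v ∈ S, s(v, a) ∈ ω} = localCylinder (↑F : Set (Sym2 (Fin n))) ↑F := by
    ext ω
    simp only [Set.mem_setOf_eq, localCylinder, hF, Finset.coe_image, Set.mem_image, Finset.mem_coe]
    constructor
    · rintro h e ⟨v, hv, rfl⟩
      exact ⟨fun _ => ⟨v, hv, rfl⟩, fun _ => h v hv⟩
    · intro h v hv
      exact ((h (s(v, a)) ⟨v, hv, rfl⟩).2 ⟨v, hv, rfl⟩)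
  have hmeas : ∀ s : Set (BondConfig (Fin n)), MeasurableSet s := fun _ => MeasurableSet.of_discrete
  have h := unglued_hyp_restrict_pairsOpen K S d a b hS hle
  rw [hcyl, prodBernoulli_real_inter_localCylinder K F ↑F (hmeas _), prodBernoulli_real_inter_localCylinder K F ↑F (hmeas _)] at h
  -- the cylinder has positive mass
  have hcylpos : 0 < (prodBernoulli K).real (localCylinder (↑F : Set (Sym2 (Fin n))) ↑F) := by
    rw [prodBernoulli_real_localCylinder]
    refine Finset.prod_pos fun e he => ?_
    obtain ⟨v, hv, rfl⟩ := Finset.mem_image.1 he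
    have : s(v, a) ∈ (↑F : Set (Sym2 (Fin n))) := Finset.mem_coe.2 he
    simp only [this, if_true]
    exact hpos v hv
  exact le_of_mul_le_mul_left h hcylpos

end FingerHypTransfer

end

end Summit.CriticalPhenomena.PercolationContinuityZ3.Theorems
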